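import Summits.QuantumFields.QCD.Theorems.ChiralDescent.Negative.DataLevelObstruction

/-!
# `ChiralDescent` (crux stmt-QuantumFields-17527, line `Sketch`) — support: TWO-TUPLE COPY RIGIDITY
# of the threshold data (why every data-level descent is "E along a subsequence")

Lead c5, cycle 6 (2026-08-17). Definition-free; imports the disprover's landed
`Theorems/ChiralDescent/Negative/DataLevelObstruction.lean` (gap transfer along eventually-equal data) and,
through it, the route module and `QCDGoldstoneBound` (`QCDRegularisation.restrict`). Nothing here asserts a
Theses decl.

The census of the line (`Cruxes/ChiralDescent/Lines/Sketch.lean`, NOTES.md) rests on the audit claim: *a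
regularisation `reg'` whose positive-mass schemes can be certified from the crux's hypothesis must, eventually
in `k`, carry the bare data of the hypothesis' regularisation `reg` read along one `ψ : ℕ → ℕ` through ONE
affine mass map `m ↦ μ + λ m`, so that `reg'.IsChiralAtZero` is literally "no uniform lattice rate of
`reg ∘ ψ` above `μ`" — statement E (along `ψ`).* This file makes the rigidity half of that claim a theorem
about the data alone:

* `copyRigidity` — if the spacings of `reg'` are eventually those of `reg ∘ ψ` and the bare trajectories of
  `reg'` at TWO distinct flavour-degenerate tuples `t₁ ≠ t₂` are eventually the trajectories of `reg ∘ ψ` at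
  some tuples `T₁, T₂`, then `λ := (T₂ − T₁)/(t₂ − t₁) > 0`, eventually `Z_m' = (Z_m ∘ ψ)/λ` and
  `m_crit' = m_crit ∘ ψ + (a ∘ ψ) μ/(Z_m ∘ ψ)` with `μ := T₁ − λ t₁`, and the trajectory of `reg'` at EVERY
  tuple `m` is eventually that of `reg ∘ ψ` at `μ + λ m` — two tuples pin the copy to
  `restrict ψ ∘ (m_crit-shift by μ) ∘ (Z_m-rescale by λ)`.
* `hasLatticeMassGap_iff_of_copy` — with also `β' = β ∘ ψ`, `L' = L ∘ ψ` eventually and `ψ → ∞`, the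
  uniform lattice gap of `reg'.scheme m` at any rate is exactly that of `(reg.restrict ψ).scheme (μ + λ m)`.
* `noUniformRate_restrict_of_isChiralAtZero_copy` — hence `reg'.IsChiralAtZero` forces: for every `ε > 0`
  some tuple with all components `> μ` at which `reg.restrict ψ` has no uniform lattice gap `ε` (the
  chirality half of E along `ψ`); `not_isChiralAtZero_copy_of_uniformGapAbove` — in particular such a `reg'`
  is not chiral at zero when `μ ≥ M₀` and `reg` is uniformly gapped above `M₀` (recovering the disprover's
  `not_isChiralAtZero_restrict_mcritShift` for every two-tuple copy, shifts and rescalings unnamed).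
-/

namespace Summit.QuantumFields.QCD.Cruxes.ChiralDescent.InfimumDescent

open Filter Topology
open Literature.MathematicalPhysics.QuantumFieldTheory
open Summit.QuantumFields.QCD.Theorems.ChiralDescent.Negative

/-- **Two-tuple copy rigidity.** Let `reg, reg'` be regularisations, `ψ : ℕ → ℕ`, `f₀` a flavour. If
eventually `a'_k = a_{ψ k}` and the bare trajectories of `reg'` at the degenerate tuples `t₁ ≠ t₂` are
eventually those of `reg` (read along `ψ`) at the degenerate tuples `T₁, T₂`, then with
`λ = (T₂ − T₁)/(t₂ − t₁)` and `μ = T₁ − λ t₁`: `0 < λ`, eventually `Z_m'(k) = Z_m(ψ k)/λ` and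
`m_crit'(k) = m_crit(ψ k) + a_{ψ k} μ / Z_m(ψ k)`, and for EVERY tuple `m` (and any species
renormalisations) the trajectory of `reg'` at `m` is eventually the trajectory of `reg` at `μ + λ m` read
along `ψ`. (Subtracting the two matching identities gives `(t₂ − t₁)/Z_m' = (T₂ − T₁)/(Z_m ∘ ψ)`.) [folklore] -/
theorem copyRigidity {Nf : ℕ} (reg reg' : QCDRegularisation Nf) (ψ : ℕ → ℕ) (f₀ : Fin Nf) {t₁ t₂ T₁ T₂ : ℝ}
    (ht : t₁ ≠ t₂) (ha : ∀ᶠ k in atTop, reg'.a k = reg.a (ψ k))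
    (h₁ : ∀ᶠ k in atTop,
      (reg'.scheme (fun _ => t₁) 0 0).mq f₀ k = (reg.scheme (fun _ => T₁) 0 0).mq f₀ (ψ k))
    (h₂ : ∀ᶠ k in atTop,
      (reg'.scheme (fun _ => t₂) 0 0).mq f₀ k = (reg.scheme (fun _ => T₂) 0 0).mq f₀ (ψ k)) :
    0 < (T₂ - T₁) / (t₂ - t₁) ∧
      (∀ᶠ k in atTop, reg'.Zm k = reg.Zm (ψ k) / ((T₂ - T₁) / (t₂ - t₁))) ∧
      (∀ᶠ k in atTop, reg'.mcrit k =
        reg.mcrit (ψ k) + reg.a (ψ k) * (T₁ - (T₂ - T₁) / (t₂ - t₁) * t₁) / reg.Zm (ψ k)) ∧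
      ∀ (m : Fin Nf → ℝ) (z s : QCDField Nf → ℕ → ℝ), ∀ᶠ k in atTop, ∀ f,
        (reg'.scheme m z s).mq f k =
          (reg.scheme (fun f => (T₁ - (T₂ - T₁) / (t₂ - t₁) * t₁) + (T₂ - T₁) / (t₂ - t₁) * m f) z s).mq
            f (ψ k) := by
  -- pointwise consequences of the two matching identities at a step `k` where all three hold
  have key : ∀ k, reg'.a k = reg.a (ψ k) →
      (reg'.scheme (fun _ => t₁) 0 0).mq f₀ k = (reg.scheme (fun _ => T₁) 0 0).mq f₀ (ψ k) →
      (reg'.scheme (fun _ => t₂) 0 0).mq f₀ k = (reg.scheme (fun _ => T₂) 0 0).mq f₀ (ψ k) →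
      (T₂ - T₁) / (t₂ - t₁) = reg.Zm (ψ k) / reg'.Zm k ∧
        reg'.mcrit k = reg.mcrit (ψ k) + reg.a (ψ k) * T₁ / reg.Zm (ψ k) - reg.a (ψ k) * t₁ / reg'.Zm k := by
    intro k hak hk₁ hk₂
    simp only [QCDRegularisation.scheme_mq, hak] at hk₁ hk₂
    have hα : 0 < reg.a (ψ k) := reg.a_pos (ψ k)
    have hZ : 0 < reg.Zm (ψ k) := reg.Zm_pos (ψ k)
    have hZ' : 0 < reg'.Zm k := reg'.Zm_pos k
    have hα0 : reg.a (ψ k) ≠ 0 := hα.ne'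
    have hZ0 : reg.Zm (ψ k) ≠ 0 := hZ.ne'
    have hZ'0 : reg'.Zm k ≠ 0 := hZ'.ne'
    have hsub : t₂ - t₁ ≠ 0 := sub_ne_zero.mpr (Ne.symm ht)
    have hu : 0 < reg.a (ψ k) / reg'.Zm k := div_pos hα hZ'
    have hv : 0 < reg.a (ψ k) / reg.Zm (ψ k) := div_pos hα hZ
    -- the identities, linear in `u = a/Z_m'` and `v = a/Z_m`
    have e₁ : reg'.mcrit k + t₁ * (reg.a (ψ k) / reg'.Zm k) =
        reg.mcrit (ψ k) + T₁ * (reg.a (ψ k) / reg.Zm (ψ k)) := by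
      rw [show t₁ * (reg.a (ψ k) / reg'.Zm k) = reg.a (ψ k) * t₁ / reg'.Zm k by ring,
        show T₁ * (reg.a (ψ k) / reg.Zm (ψ k)) = reg.a (ψ k) * T₁ / reg.Zm (ψ k) by ring]
      exact hk₁
    have e₂ : reg'.mcrit k + t₂ * (reg.a (ψ k) / reg'.Zm k) =
        reg.mcrit (ψ k) + T₂ * (reg.a (ψ k) / reg.Zm (ψ k)) := by
      rw [show t₂ * (reg.a (ψ k) / reg'.Zm k) = reg.a (ψ k) * t₂ / reg'.Zm k by ring,
        show T₂ * (reg.a (ψ k) / reg.Zm (ψ k)) = reg.a (ψ k) * T₂ / reg.Zm (ψ k) by ring]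
      exact hk₂
    have elin : (t₂ - t₁) * (reg.a (ψ k) / reg'.Zm k) = (T₂ - T₁) * (reg.a (ψ k) / reg.Zm (ψ k)) := by
      linarith
    -- `T₂ - T₁ = (t₂ - t₁) · Z_m / Z_m'`
    have hT : T₂ - T₁ = (t₂ - t₁) * (reg.Zm (ψ k) / reg'.Zm k) := by
      have h1 : T₂ - T₁ = (t₂ - t₁) * (reg.a (ψ k) / reg'.Zm k) / (reg.a (ψ k) / reg.Zm (ψ k)) := by
        rw [eq_div_iff hv.ne']
        linarith
      rw [h1]
      field_simp
    refine ⟨?_, ?_⟩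
    · rw [hT]
      field_simp
    · linarith
  have hev : ∀ᶠ k in atTop, (T₂ - T₁) / (t₂ - t₁) = reg.Zm (ψ k) / reg'.Zm k ∧
      reg'.mcrit k = reg.mcrit (ψ k) + reg.a (ψ k) * T₁ / reg.Zm (ψ k) - reg.a (ψ k) * t₁ / reg'.Zm k := by
    filter_upwards [ha, h₁, h₂] with k hak hk₁ hk₂ using key k hak hk₁ hk₂
  -- positivity of `λ` from any one step
  obtain ⟨k₀, hk₀⟩ := hev.exists
  have hpos : 0 < (T₂ - T₁) / (t₂ - t₁) := by
    rw [hk₀.1]; exact div_pos (reg.Zm_pos _) (reg'.Zm_pos _)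
  -- `Z_m' = Z_m ∘ ψ / λ` at every step where `λ = Z_m (ψ k) / Z_m' k`
  have hZm : ∀ k, (T₂ - T₁) / (t₂ - t₁) = reg.Zm (ψ k) / reg'.Zm k →
      reg'.Zm k = reg.Zm (ψ k) / ((T₂ - T₁) / (t₂ - t₁)) := by
    intro k hk
    have hZ0 : reg.Zm (ψ k) ≠ 0 := (reg.Zm_pos (ψ k)).ne'
    have hZ'0 : reg'.Zm k ≠ 0 := (reg'.Zm_pos k).ne'
    rw [hk]
    field_simp
  refine ⟨hpos, hev.mono fun k hk => hZm k hk.1, ?_, fun m z s => ?_⟩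
  · filter_upwards [hev] with k hk
    have hZ0 : reg.Zm (ψ k) ≠ 0 := (reg.Zm_pos (ψ k)).ne'
    have hl0 : (T₂ - T₁) / (t₂ - t₁) ≠ 0 := hpos.ne'
    rw [hk.2, hZm k hk.1]
    field_simp
    ring
  · filter_upwards [ha, hev] with k hak hk f
    have hZ0 : reg.Zm (ψ k) ≠ 0 := (reg.Zm_pos (ψ k)).ne'
    have hl0 : (T₂ - T₁) / (t₂ - t₁) ≠ 0 := hpos.ne'
    simp only [QCDRegularisation.scheme_mq, hak, hk.2, hZm k hk.1]
    field_simp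
    ring

/-- **The uniform lattice gap of a two-tuple copy is that of the reindexed threshold family at the
affine image.** Under the hypotheses of `copyRigidity` together with `β' = β ∘ ψ`, `L' = L ∘ ψ`
eventually and `ψ → ∞`, for every tuple `m`, species renormalisations and rate `Δ`:
`reg'.scheme m` is uniformly gapped at rate `Δ` iff `(reg.restrict ψ).scheme (μ + λ m)` is
(both directions are `hasLatticeMassGap_of_eventually_comp`, the clause reading only `(β, L, a, m_f)`). [folklore] -/
theorem hasLatticeMassGap_iff_of_copy {Nf : ℕ} (reg reg' : QCDRegularisation Nf) (ψ : ℕ → ℕ)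
    (hψ : Tendsto ψ atTop atTop) (f₀ : Fin Nf) {t₁ t₂ T₁ T₂ : ℝ} (ht : t₁ ≠ t₂)
    (ha : ∀ᶠ k in atTop, reg'.a k = reg.a (ψ k)) (hβ : ∀ᶠ k in atTop, reg'.β k = reg.β (ψ k))
    (hL : ∀ᶠ k in atTop, reg'.L k = reg.L (ψ k))
    (h₁ : ∀ᶠ k in atTop,
      (reg'.scheme (fun _ => t₁) 0 0).mq f₀ k = (reg.scheme (fun _ => T₁) 0 0).mq f₀ (ψ k))
    (h₂ : ∀ᶠ k in atTop,
      (reg'.scheme (fun _ => t₂) 0 0).mq f₀ k = (reg.scheme (fun _ => T₂) 0 0).mq f₀ (ψ k))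
    (m : Fin Nf → ℝ) (z s : QCDField Nf → ℕ → ℝ) (Δ : ℝ) :
    (reg'.scheme m z s).HasLatticeMassGap Δ ↔
      ((reg.restrict ψ hψ).scheme
        (fun f => (T₁ - (T₂ - T₁) / (t₂ - t₁) * t₁) + (T₂ - T₁) / (t₂ - t₁) * m f) z s).HasLatticeMassGap Δ := by
  obtain ⟨-, -, -, hmq⟩ := copyRigidity reg reg' ψ f₀ ht ha h₁ h₂
  constructor
  · -- `reg'` gapped ⇒ the reindexed family gapped: the data agree eventually along `φ = id`
    refine fun h => hasLatticeMassGap_of_eventually_comp (φ := id) tendsto_id ?_ h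
    filter_upwards [ha, hβ, hL, hmq m z s] with k hak hbk hLk hk
    refine ⟨hbk.symm, hLk.symm, hak.symm, fun f => ?_⟩
    rw [QCDRegularisation.restrict_scheme_mq]
    exact (hk f).symm
  · -- the reindexed family gapped ⇒ `reg'` gapped: the data agree eventually along `φ = id`
    refine fun h => hasLatticeMassGap_of_eventually_comp (φ := id) tendsto_id ?_ h
    filter_upwards [ha, hβ, hL, hmq m z s] with k hak hbk hLk hk
    exact ⟨hbk, hLk, hak, fun f => by rw [QCDRegularisation.restrict_scheme_mq]; exact hk f⟩

/-- **Chirality of a two-tuple copy is gap-closing of the reindexed threshold family above `μ`.** Under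
the hypotheses of `hasLatticeMassGap_iff_of_copy`, if `reg'` is chiral at zero then for every `ε > 0`
there is a tuple with all components `> μ = T₁ − λ t₁` at which `reg.restrict ψ` has no uniform lattice
gap `ε` — the chirality half of statement E for `reg ∘ ψ` at the offset `μ` (the positive tuple `m` of
`IsChiralAtZero` maps to `μ + λ m`, `λ > 0`). [folklore] -/
theorem noUniformRate_restrict_of_isChiralAtZero_copy {Nf : ℕ} (reg reg' : QCDRegularisation Nf) (ψ : ℕ → ℕ)
    (hψ : Tendsto ψ atTop atTop) (f₀ : Fin Nf) {t₁ t₂ T₁ T₂ : ℝ} (ht : t₁ ≠ t₂)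
    (ha : ∀ᶠ k in atTop, reg'.a k = reg.a (ψ k)) (hβ : ∀ᶠ k in atTop, reg'.β k = reg.β (ψ k))
    (hL : ∀ᶠ k in atTop, reg'.L k = reg.L (ψ k))
    (h₁ : ∀ᶠ k in atTop,
      (reg'.scheme (fun _ => t₁) 0 0).mq f₀ k = (reg.scheme (fun _ => T₁) 0 0).mq f₀ (ψ k))
    (h₂ : ∀ᶠ k in atTop,
      (reg'.scheme (fun _ => t₂) 0 0).mq f₀ k = (reg.scheme (fun _ => T₂) 0 0).mq f₀ (ψ k))
    (hχ : reg'.IsChiralAtZero) :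
    ∀ ε > (0 : ℝ), ∃ M : Fin Nf → ℝ, (∀ f, T₁ - (T₂ - T₁) / (t₂ - t₁) * t₁ < M f) ∧
      ¬ ((reg.restrict ψ hψ).scheme M 0 0).HasLatticeMassGap ε := by
  intro ε hε
  obtain ⟨m, hm, hno⟩ := hχ ε hε
  have hpos := (copyRigidity reg reg' ψ f₀ ht ha h₁ h₂).1
  refine ⟨fun f => (T₁ - (T₂ - T₁) / (t₂ - t₁) * t₁) + (T₂ - T₁) / (t₂ - t₁) * m f,
    fun f => lt_add_of_pos_right _ (mul_pos hpos (hm f)), fun hg => hno ?_⟩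
  exact (hasLatticeMassGap_iff_of_copy reg reg' ψ hψ f₀ ht ha hβ hL h₁ h₂ m 0 0 ε).mpr hg

/-- **A two-tuple copy landing above a uniformly gapped offset is not chiral at zero.** If `reg` is
uniformly gapped (one rate `ε`) at every tuple above `M₀` and the offset `μ = T₁ − λ t₁` of the copy is
`≥ M₀`, then `reg'` is not chiral at zero — the disprover's data-level obstruction for every regularisation
agreeing with the threshold data at two tuples (shifts, rescalings of `Z_m`, subsequences and finite
modifications all unnamed). [folklore] -/
theorem not_isChiralAtZero_copy_of_uniformGapAbove {Nf : ℕ} (reg reg' : QCDRegularisation Nf) (ψ : ℕ → ℕ)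
    (hψ : Tendsto ψ atTop atTop) (f₀ : Fin Nf) {t₁ t₂ T₁ T₂ M₀ ε : ℝ} (ht : t₁ ≠ t₂) (hε : 0 < ε)
    (ha : ∀ᶠ k in atTop, reg'.a k = reg.a (ψ k)) (hβ : ∀ᶠ k in atTop, reg'.β k = reg.β (ψ k))
    (hL : ∀ᶠ k in atTop, reg'.L k = reg.L (ψ k))
    (h₁ : ∀ᶠ k in atTop,
      (reg'.scheme (fun _ => t₁) 0 0).mq f₀ k = (reg.scheme (fun _ => T₁) 0 0).mq f₀ (ψ k))
    (h₂ : ∀ᶠ k in atTop,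
      (reg'.scheme (fun _ => t₂) 0 0).mq f₀ k = (reg.scheme (fun _ => T₂) 0 0).mq f₀ (ψ k))
    (hμ : M₀ ≤ T₁ - (T₂ - T₁) / (t₂ - t₁) * t₁)
    (hgap : ∀ m : Fin Nf → ℝ, (∀ f, M₀ < m f) → (reg.scheme m 0 0).HasLatticeMassGap ε) :
    ¬ reg'.IsChiralAtZero := by
  intro hχ
  obtain ⟨M, hM, hno⟩ :=
    noUniformRate_restrict_of_isChiralAtZero_copy reg reg' ψ hψ f₀ ht ha hβ hL h₁ h₂ hχ ε hε
  exact hno (hasLatticeMassGap_restrict reg ψ hψ M 0 0 (hgap M fun f => lt_of_le_of_lt hμ (hM f)))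

end Summit.QuantumFields.QCD.Cruxes.ChiralDescent.InfimumDescent
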